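import Literature.MathematicalPhysics.QuantumFieldTheory.Balaban1983to89.B8

/-!
# `Balaban1983to89.B8Thm2AtConstants` — T. Bałaban, *Spaces of regular gauge field configurations on a lattice and gauge fixing
# conditions*, Commun. Math. Phys. **99** (1985) 75–102 [Balaban1985RegularSpaces] = cell paper B8: the printed reduction
# «Theorem 4 + Proposition 3 + (1.65) ⇒ Theorem 2» (p. 88) AT EXPLICIT CONSTANTS — Theorem 2's body at `B₁ = 5dLB₀`, `B₂(β₀) = 5dLB₀(β₀)`
# and ANY threshold `c₁` below the displayed schedule, from the BODIES of Theorem 4 and Proposition 3 (interface form for the consumers of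
# node N05's leaf that fix Theorem 2's constants as carrier fields — [Balaban1985Variational] p. 296 «we have B₁ = 5dLB₀»)

statement-level skeleton of published theorems with citation tags; proofs where landed; nothing here is a claim about the Yang–Mills mass gap

CITATION HEADER (lean-in-tree rule).  Cell `pub-ymgap` (YM-PLAN Track A, HUMAN RULING D-0062), seat `pub-ymgap-dag-n05-a` (KNIT-BY-NAME seat of DAG
node N05 = [B8]); companion of `…B8LeafKnit` (p408782).  It answers the INTERFACE FINDING (F1) of the N07 knit seat (`…B11LeafKnit`,
pub-ymgap INBOX 2026-08-25 [DAGN07A-G0-LANDED-1]): the N07 leaf `DagBinding.B11Leaf Z` fixes [6]'s constants `B₁` (= `5dLB₀`,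
`B11.B1_eq_B8Prop3`) and `c₁` as FIELDS of its carrier bundle, whereas node N05's conjunct `t2 : B8.Thm2Printed` — and the tree's kernel form
of the p. 88 reduction, `B8.thm2_of_thm4_prop3` — deliver Theorem 2 with EXISTENTIALLY quantified `B₁, B₂, c₁` (the threshold hidden in
`B8.thm2_schedule_exists`).  Here the same reduction is run AT CONSTANTS: the threshold schedule is DISPLAYED (`thm2_schedule_of_le`: any
`c₁ ≤ min{c₀, c₄∕K, c₃, c₃∕(B′₁K), 1∕D}`, `K = 1 + 11d²`, `D = B′₁K(2(1 + C₂)B′₁K + 20d) + 1` works), and Theorem 2's existence half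
(`thm2ExistsAt_of_bodies`) and uniqueness half (`thm2UniqueAt_of_bodies`) are proved at `B₁ = 5dLB₀`, `B₂ = 5dLB₀(β₀)` and every scheduled
`c₁`, from `B8.Thm4Body c₄ B′₁`, `B8.Prop3Body c₃` and the (1.65) threshold `c₀` with the SAME six displayed carrier laws as
`B8.thm2_of_thm4_prop3`; `thm2Printed_of_bodies` re-packages them as `B8.Thm2Printed` (consistency with the ∃-form).  THEOREMS ONLY (no
`def`: the schedule is a hypothesis `Thm2Schedule`-shaped ∀-statement written out, not a named constant); ONE import `…B8`; nothing of
`…B8` is edited.  PDF held: `paper:balaban1985-cmp99-regular-spaces-gauge-fixing` (journal page = PDF page + 74); the printed sentences are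
quoted verbatim in `…B8` (`Thm2Printed` p. 83, `Prop3Body` pp. 86–87, `Thm4Body` p. 88, `thm2_of_thm4_prop3` p. 88).

WHAT IS PRINTED (p. 88 [PDF 14], through `B8.thm2_of_thm4_prop3`'s docstring): *"Thus to prove Theorem 2 it suffices to prove (1.37), (1.38)
and |A| < B′₁(α₀ + α₁)(Lʲη)⁻¹"* with (1.35) ⇒ (1.66) in the form (1.65) `|Ũ′ʲ − 1| < 11d²α₀ + α₁`; Theorem 2 p. 83: *"There exist constants
B₁, B₂(β₀), c₁ such that for arbitrary U₀, U′U₀ satisfying (1.33)–(1.35) with α₀ + α₁ ≤ c₁ there exists exactly one gauge transformation u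
satisfying (1.29) and such that the conditions (1.36)–(1.39) hold for the configuration U₁ = U′^{u⁻¹}."*; Prop. 3 p. 87: *"… with
B₁ = 5dLB₀, B₂(β₀) = 5dLB₀(β₀)"*.

WHAT THIS FILE PROVES (0 sorry; axioms standard; every proof is `B8.thm2_of_thm4_prop3`'s with the threshold exposed).
* `thm2_schedule_of_le` — the SCHEDULE (the ∀-body of `B8.thm2_schedule_exists`) for EVERY `c₁` with `c₁ ≤ c₀`, `K c₁ ≤ c₄`, `c₁ ≤ c₃`,
  `B′₁K c₁ ≤ c₃`, `D c₁ ≤ 1` (`K`, `D` as above, written out): `α₀ + α₁ ≤ c₁` forces `α₀ ≤ c₀`, Theorem 4 applicable at `(α₀, 11d²α₀ + α₁)`,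
  Proposition 3 applicable at `(α₀, α₁, α₂ = B′₁(α₀ + 11d²α₀ + α₁))` including (1.61).
* `thm2ExistsAt_of_bodies` — Theorem 2's EXISTENCE half at `(5dLB₀, 5dLB₀(β₀), c₁)`: a (1.29)-restricted `u` with (1.36), (1.37), (1.38), (1.39)
  for `U₁ = U′^{u⁻¹}`, for every scheduled `c₁` (hypothesis `hsched`), from `Thm4Body c₄ B′₁`, `Prop3Body c₃`, (1.65) at `c₀` and the laws
  `hginv`, `h137`, `hmono162` — exactly the shape `…B11LeafKnit.prop2_of_thm2At` consumes (its hypothesis `H`, with `Z.B₁ = 5dLB₀`, `Z.c₁ = c₁`).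
* `thm2UniqueAt_of_bodies` — the UNIQUENESS half at the same constants (a second restricted `u′` with (1.36)–(1.39) equals `u`), from the same
  inputs plus `h136_162`, `hmono137` and `5dLB₀ ≤ B′₁`.
* `thm2Printed_of_bodies` — the two halves re-packaged as `B8.Thm2Printed` (= `B8.thm2_of_thm4_prop3` read through the bodies).

HONEST SCOPE ∕ NOT CLAIMED.  (i) Nothing printed is proved here beyond bookkeeping: Theorem 4, Proposition 3 and (1.65) are HYPOTHESES (their
BODIES at given thresholds); the file only makes the p. 88 schedule's threshold explicit so that a consumer pinning `c₁` as a carrier field can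
be served by name once the -b seats land `Thm4Body` ∕ `Prop3Body` with explicit thresholds on the B8 family of record (NODE 00 question N0-6).
(ii) The constants are print's (`B₁ = 5dLB₀`, `B₂ = 5dLB₀(β₀)`, Prop. 3 p. 87); the threshold formula is the sub-cell b08's schedule (census
C-B8-12: Theorem 4 is invoked at `(α₀, 11d²α₀ + α₁)`), not a printed number («α₀ + α₁ ≤ c₁» only).  (iii) COUNT-NEUTRAL; not a discharge of N05 or
N07; one finite four-torus programme at fixed ε, Bałaban AS PRINTED; nothing continuum ∕ ℝ⁴ ∕ OS ∕ mass gap ∕ Clay.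
-/

namespace Literature.MathematicalPhysics.QuantumFieldTheory.Balaban1983to89.B8Thm2AtConstants

variable {I : Type}

/-- **The p. 88 smallness schedule at an EXPLICIT threshold** (the ∀-body of `B8.thm2_schedule_exists`, whose `c₁` is the `min` written out here):
with `K = 1 + 11d²` and `D = B′₁K(2(1 + C₂)B′₁K + 20d) + 1`, EVERY `c₁` with `c₁ ≤ c₀`, `Kc₁ ≤ c₄`, `c₁ ≤ c₃`, `B′₁Kc₁ ≤ c₃`, `Dc₁ ≤ 1`
schedules Theorem 4 at `(α₀, 11d²α₀ + α₁)`, Proposition 3 at `(α₀, α₁, α₂ = B′₁(α₀ + 11d²α₀ + α₁))` and the restriction (1.61), whenever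
`α₀ + α₁ ≤ c₁`. [cite: Balaban1985RegularSpaces, (1.61) p.86, (1.63)–(1.67) pp.87–88 (the reduction's smallness bookkeeping, threshold made explicit)] -/
theorem thm2_schedule_of_le {d c₀ c₃ c₄ B₁' C₂ c₁ : ℝ} (hd : 0 ≤ d) (hB : 0 < B₁') (hC₂ : 0 ≤ C₂)
    (e₀ : c₁ ≤ c₀) (e₄ : (1 + 11 * d ^ 2) * c₁ ≤ c₄) (e₃ : c₁ ≤ c₃) (e₃' : B₁' * (1 + 11 * d ^ 2) * c₁ ≤ c₃)
    (eD : (B₁' * (1 + 11 * d ^ 2) * (2 * (1 + C₂) * B₁' * (1 + 11 * d ^ 2) + 20 * d) + 1) * c₁ ≤ 1) :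
    ∀ α₀ α₁ : ℝ, 0 < α₀ → 0 < α₁ → α₀ + α₁ ≤ c₁ →
      α₀ ≤ c₀ ∧ α₀ + (11 * d ^ 2 * α₀ + α₁) ≤ c₄ ∧ α₀ ≤ c₃ ∧ α₁ ≤ c₃ ∧
      B₁' * (α₀ + (11 * d ^ 2 * α₀ + α₁)) ≤ c₃ ∧
      2 * (B₁' * (α₀ + (11 * d ^ 2 * α₀ + α₁))) ^ 2 + 20 * d * α₀ * (B₁' * (α₀ + (11 * d ^ 2 * α₀ + α₁))) +
        2 * C₂ * (B₁' * (α₀ + (11 * d ^ 2 * α₀ + α₁))) ^ 2 ≤ α₀ + α₁ := by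
  set K : ℝ := 1 + 11 * d ^ 2 with hK
  have hK1 : 1 ≤ K := by rw [hK]; nlinarith [sq_nonneg d]
  have hKpos : 0 < K := by linarith
  set D : ℝ := B₁' * K * (2 * (1 + C₂) * B₁' * K + 20 * d) + 1 with hD
  have hDpos : 0 < D := by
    have : 0 ≤ B₁' * K * (2 * (1 + C₂) * B₁' * K + 20 * d) := by positivity
    linarith
  intro α₀ α₁ h0 h1 hs
  set s := α₀ + α₁ with hs_def
  have hs0 : 0 < s := by linarith
  have hsc : s ≤ c₁ := hs
  -- the auxiliary quantity α₀ + α₁′ = Kα₀ + α₁ ≤ K s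
  have hKs : α₀ + (11 * d ^ 2 * α₀ + α₁) ≤ K * s := by
    rw [hK, hs_def]; nlinarith [sq_nonneg d, mul_nonneg (mul_nonneg (by norm_num : (0:ℝ) ≤ 11) (sq_nonneg d)) h1.le]
  have hKs0 : 0 ≤ α₀ + (11 * d ^ 2 * α₀ + α₁) := by positivity
  have hKsc : K * s ≤ K * c₁ := mul_le_mul_of_nonneg_left hsc hKpos.le
  refine ⟨by linarith, by linarith, by linarith, by linarith, ?_, ?_⟩
  · have hBK : B₁' * (α₀ + (11 * d ^ 2 * α₀ + α₁)) ≤ B₁' * K * s := by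
      have := mul_le_mul_of_nonneg_left hKs hB.le; linarith [this]
    have hBKpos : 0 < B₁' * K := by positivity
    have : B₁' * K * s ≤ B₁' * K * c₁ := mul_le_mul_of_nonneg_left hsc hBKpos.le
    linarith
  · -- (1.61) at α₂ = B′₁(α₀ + α₁′): 2(1+C₂)α₂² + 20dα₀α₂ ≤ s²·B′₁K(2(1+C₂)B′₁K + 20d) ≤ s²D ≤ s
    set α₂ := B₁' * (α₀ + (11 * d ^ 2 * α₀ + α₁)) with hα₂
    have hα₂0 : 0 ≤ α₂ := by positivity
    have hα₂le : α₂ ≤ B₁' * K * s := by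
      have := mul_le_mul_of_nonneg_left hKs hB.le; rw [hα₂]; linarith [this]
    have hsq : α₂ ^ 2 ≤ (B₁' * K * s) ^ 2 := pow_le_pow_left₀ hα₂0 hα₂le 2
    have hα₀s : α₀ ≤ s := by linarith
    have hprod : α₀ * α₂ ≤ s * (B₁' * K * s) := mul_le_mul hα₀s hα₂le hα₂0 hs0.le
    have hsD : s * D ≤ 1 := by
      have h1' : s * D ≤ c₁ * D := mul_le_mul_of_nonneg_right hsc hDpos.le
      have h2' : c₁ * D ≤ 1 := by rw [mul_comm]; exact eD
      linarith
    have hmain : 2 * α₂ ^ 2 + 20 * d * α₀ * α₂ + 2 * C₂ * α₂ ^ 2 ≤ s * (s * D) := by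
      have h2 : 2 * (1 + C₂) * α₂ ^ 2 ≤ 2 * (1 + C₂) * (B₁' * K * s) ^ 2 :=
        mul_le_mul_of_nonneg_left hsq (by positivity)
      have h3 : 20 * d * (α₀ * α₂) ≤ 20 * d * (s * (B₁' * K * s)) :=
        mul_le_mul_of_nonneg_left hprod (by positivity)
      have hss : 0 ≤ s * s := by positivity
      rw [hD]; nlinarith [h2, h3, hss]
    have : s * (s * D) ≤ s := by
      have := mul_le_mul_of_nonneg_left hsD hs0.le; simpa using this
    linarith

/-- **Non-vacuity of the explicit schedule**: for positive data the five threshold conditions are met by some `c₁ > 0` (so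
`thm2_schedule_of_le` recovers `B8.thm2_schedule_exists`). [cite: Balaban1985RegularSpaces, (1.63)–(1.67) pp.87–88 (bookkeeping)] -/
theorem thm2_schedule_threshold_exists {d c₀ c₃ c₄ B₁' C₂ : ℝ} (hd : 0 ≤ d) (hc₀ : 0 < c₀) (hc₃ : 0 < c₃) (hc₄ : 0 < c₄)
    (hB : 0 < B₁') (hC₂ : 0 ≤ C₂) :
    ∃ c₁ : ℝ, 0 < c₁ ∧ c₁ ≤ c₀ ∧ (1 + 11 * d ^ 2) * c₁ ≤ c₄ ∧ c₁ ≤ c₃ ∧ B₁' * (1 + 11 * d ^ 2) * c₁ ≤ c₃ ∧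
      (B₁' * (1 + 11 * d ^ 2) * (2 * (1 + C₂) * B₁' * (1 + 11 * d ^ 2) + 20 * d) + 1) * c₁ ≤ 1 := by
  set K : ℝ := 1 + 11 * d ^ 2 with hK
  have hKpos : 0 < K := by rw [hK]; positivity
  set D : ℝ := B₁' * K * (2 * (1 + C₂) * B₁' * K + 20 * d) + 1 with hD
  have hDpos : 0 < D := by
    have : 0 ≤ B₁' * K * (2 * (1 + C₂) * B₁' * K + 20 * d) := by positivity
    linarith
  have hBK : 0 < B₁' * K := by positivity
  refine ⟨min c₀ (min (c₄ / K) (min c₃ (min (c₃ / (B₁' * K)) (1 / D)))), ?_, min_le_left _ _, ?_, ?_, ?_, ?_⟩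
  · exact lt_min hc₀ (lt_min (by positivity) (lt_min hc₃ (lt_min (by positivity) (by positivity))))
  · have e : min c₀ (min (c₄ / K) (min c₃ (min (c₃ / (B₁' * K)) (1 / D)))) ≤ c₄ / K :=
      (min_le_right _ _).trans (min_le_left _ _)
    have := (le_div_iff₀ hKpos).1 e
    linarith [this]
  · exact (min_le_right _ _).trans ((min_le_right _ _).trans (min_le_left _ _))
  · have e : min c₀ (min (c₄ / K) (min c₃ (min (c₃ / (B₁' * K)) (1 / D)))) ≤ c₃ / (B₁' * K) :=
      (min_le_right _ _).trans ((min_le_right _ _).trans ((min_le_right _ _).trans (min_le_left _ _)))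
    have := (le_div_iff₀ hBK).1 e
    linarith [this]
  · have e : min c₀ (min (c₄ / K) (min c₃ (min (c₃ / (B₁' * K)) (1 / D)))) ≤ 1 / D :=
      (min_le_right _ _).trans ((min_le_right _ _).trans ((min_le_right _ _).trans (min_le_right _ _)))
    have := (le_div_iff₀ hDpos).1 e
    linarith [this]

section AtConstants

variable {d : ℕ} {L C₂ B₁' : ℝ} {inp : B8.B9Inputs} {B₀β : ℝ} {fam : I → B8.GFData2} {c₀ c₃ c₄ c₁ : ℝ}

/-- **THEOREM 2's EXISTENCE HALF AT CONSTANTS** `B₁ = 5dLB₀`, `B₂ = 5dLB₀(β₀)` and a scheduled threshold `c₁` (p. 88 «Theorem 4 ⇒ Theorem 2»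
run with the threshold exposed): from the BODIES of Theorem 4 (threshold `c₄`, constant `B′₁ > 0`) and Proposition 3 (threshold `c₃`), the
(1.65) threshold `c₀` and the displayed carrier laws `hginv` (gauge invariance of 𝔄_k), `h137` ((1.37) from the construction),
`hmono162` (monotonicity of (1.62)), under the schedule `hsched` (supplied by `thm2_schedule_of_le`): for `U₀, U′U₀` with (1.33)–(1.35) and
`α₀ + α₁ ≤ c₁` a (1.29)-restricted `u` with (1.36), (1.37), (1.38), (1.39) for `U₁ = U′^{u⁻¹}`.  This is the hypothesis `H` of
`B11LeafKnit.prop2_of_thm2At` ([Balaban1985Variational] p. 280–281, `Z.B₁ = 5dLB₀`). [cite: Balaban1985RegularSpaces, Thm 2 (1.36)–(1.39) p.83 with Thm 4 ⇒ Thm 2 p.88, Prop. 3 p.87 (bodies as hypotheses; bookkeeping at explicit constants)] -/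
theorem thm2ExistsAt_of_bodies (hd : 1 ≤ d) (hB : 0 < B₁')
    (h4 : B8.Thm4Body c₄ B₁' (fun i => (fam i).toGFData))
    (h3 : B8.Prop3Body c₃ d L C₂ inp B₀β fam)
    (hsched : ∀ α₀ α₁ : ℝ, 0 < α₀ → 0 < α₁ → α₀ + α₁ ≤ c₁ →
      α₀ ≤ c₀ ∧ α₀ + (11 * d ^ 2 * α₀ + α₁) ≤ c₄ ∧ α₀ ≤ c₃ ∧ α₁ ≤ c₃ ∧
      B₁' * (α₀ + (11 * d ^ 2 * α₀ + α₁)) ≤ c₃ ∧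
      2 * (B₁' * (α₀ + (11 * d ^ 2 * α₀ + α₁))) ^ 2 + 20 * d * α₀ * (B₁' * (α₀ + (11 * d ^ 2 * α₀ + α₁))) +
        2 * C₂ * (B₁' * (α₀ + (11 * d ^ 2 * α₀ + α₁))) ^ 2 ≤ α₀ + α₁)
    (h165 : ∀ i α₀ α₁ (U₀ : (fam i).Cfg) (U' : (fam i).Pert), 0 < α₀ → α₀ ≤ c₀ →
      (fam i).InA α₀ U₀ → (fam i).InAAx α₀ U₀ U' → (fam i).avgClose α₁ U₀ U' →
      (fam i).avgClose166 (11 * d ^ 2 * α₀ + α₁) U₀ U')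
    (hginv : ∀ i α₀ (U₀ : (fam i).Cfg) (U' : (fam i).Pert) (u : (fam i).GT),
      (fam i).InAAx α₀ U₀ U' → (fam i).InAPair α₀ U₀ ((fam i).act U' u))
    (h137 : ∀ i α₁ b s (U₀ : (fam i).Cfg) (U' : (fam i).Pert) (u : (fam i).GT), (fam i).avgClose α₁ U₀ U' →
      (fam i).Restricted U₀ u → (fam i).C162 b s U₀ ((fam i).act U' u) → (fam i).C137 α₁ U₀ ((fam i).act U' u))
    (hmono162 : ∀ i b s b' s' (U₀ : (fam i).Cfg) (U₁ : (fam i).Pert), b * s ≤ b' * s' →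
      (fam i).C162 b s U₀ U₁ → (fam i).C162 b' s' U₀ U₁) :
    ∀ i : I, ∀ α₀ α₁ : ℝ, 0 < α₀ → 0 < α₁ → α₀ + α₁ ≤ c₁ →
      ∀ U₀ : (fam i).Cfg, ∀ U' : (fam i).Pert,
        (fam i).InA α₀ U₀ → (fam i).Reg335 α₀ U₀ → (fam i).InAAx α₀ U₀ U' → (fam i).avgClose α₁ U₀ U' →
          ∃ u : (fam i).GT, (fam i).Restricted U₀ u ∧
            ((fam i).C136 (5 * d * L * inp.B₀) (5 * d * L * B₀β) (α₀ + α₁) U₀ ((fam i).act U' u) ∧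
              (fam i).C137 α₁ U₀ ((fam i).act U' u) ∧ (fam i).Landau U₀ ((fam i).act U' u) ∧
              (fam i).C139 (5 * d * L * inp.B₀) (α₀ + α₁) U₀ ((fam i).act U' u)) := by
  intro i α₀ α₁ h0 h1 hs U₀ U' hA hReg hAx hcl
  obtain ⟨e0, e4, e3a, e3b, e3c, e61⟩ := hsched α₀ α₁ h0 h1 hs
  have hd' : (0 : ℝ) < d := by exact_mod_cast hd
  set α₁' := 11 * (d : ℝ) ^ 2 * α₀ + α₁ with hα₁'
  have hα₁'pos : 0 < α₁' := by rw [hα₁']; positivity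
  -- (1.65): the hypotheses (1.33)–(1.35) give (1.66) with α₁′
  have h166 := h165 i α₀ α₁ U₀ U' h0 e0 hA hAx hcl
  -- Theorem 4 at (α₀, α₁′)
  obtain ⟨u, hu, ⟨_, h38, h62⟩, _⟩ := h4 i α₀ α₁' h0 hα₁'pos e4 U₀ U' hA hReg hAx h166
  -- Proposition 3 at (α₀, α₁, α₂ = B′₁(α₀ + α₁′)) for U₁ = U′^{u⁻¹}
  set α₂ := B₁' * (α₀ + α₁') with hα₂
  have hα₂pos : 0 < α₂ := by rw [hα₂]; positivity
  have h41 : (fam i).C162 1 α₂ U₀ ((fam i).act U' u) :=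
    hmono162 i B₁' (α₀ + α₁') 1 α₂ U₀ _ (by rw [hα₂]; ring_nf; rfl) h62
  have h37 : (fam i).C137 α₁ U₀ ((fam i).act U' u) := h137 i α₁ B₁' (α₀ + α₁') U₀ U' u hcl hu h62
  obtain ⟨h36, h39⟩ := h3 i α₀ α₁ α₂ h0 e3a h1 e3b hα₂pos e3c e61 U₀ ((fam i).act U' u)
    hA hReg (hginv i α₀ U₀ U' u hAx) h41 h38 h37
  exact ⟨u, hu, h36, h37, h38, h39⟩

/-- **THEOREM 2's UNIQUENESS HALF AT THE SAME CONSTANTS**: under `α₀ + α₁ ≤ c₁` (scheduled), two (1.29)-restricted `u, u′` with (1.36)–(1.39)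
for `U′^{u⁻¹}`, `U′^{u′⁻¹}` at `B₁ = 5dLB₀`, `B₂ = 5dLB₀(β₀)` coincide — by Theorem 4's uniqueness clause at `(α₀, 11d²α₀ + α₁)`, since (1.36)'s
first member is (1.62) at `5dLB₀ ≤ B′₁` (`h136_162`, `hmono162`, (1.111) `B′₁ = C′₁B₁`, `C′₁ ≥ 1`) and (1.37) is monotone (`hmono137`).
[cite: Balaban1985RegularSpaces, Thm 2 p.83 («exactly one»), Thm 4 p.88, (1.111) p.95 (bookkeeping at explicit constants)] -/
theorem thm2UniqueAt_of_bodies (hd : 1 ≤ d) (hL : 0 < L) (hB₁' : 5 * d * L * inp.B₀ ≤ B₁')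
    (h4 : B8.Thm4Body c₄ B₁' (fun i => (fam i).toGFData))
    (hsched : ∀ α₀ α₁ : ℝ, 0 < α₀ → 0 < α₁ → α₀ + α₁ ≤ c₁ →
      α₀ ≤ c₀ ∧ α₀ + (11 * d ^ 2 * α₀ + α₁) ≤ c₄ ∧ α₀ ≤ c₃ ∧ α₁ ≤ c₃ ∧
      B₁' * (α₀ + (11 * d ^ 2 * α₀ + α₁)) ≤ c₃ ∧
      2 * (B₁' * (α₀ + (11 * d ^ 2 * α₀ + α₁))) ^ 2 + 20 * d * α₀ * (B₁' * (α₀ + (11 * d ^ 2 * α₀ + α₁))) +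
        2 * C₂ * (B₁' * (α₀ + (11 * d ^ 2 * α₀ + α₁))) ^ 2 ≤ α₀ + α₁)
    (h165 : ∀ i α₀ α₁ (U₀ : (fam i).Cfg) (U' : (fam i).Pert), 0 < α₀ → α₀ ≤ c₀ →
      (fam i).InA α₀ U₀ → (fam i).InAAx α₀ U₀ U' → (fam i).avgClose α₁ U₀ U' →
      (fam i).avgClose166 (11 * d ^ 2 * α₀ + α₁) U₀ U')
    (h136_162 : ∀ i b b₂ s (U₀ : (fam i).Cfg) (U₁ : (fam i).Pert),
      (fam i).C136 b b₂ s U₀ U₁ → (fam i).C162 b s U₀ U₁)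
    (hmono162 : ∀ i b s b' s' (U₀ : (fam i).Cfg) (U₁ : (fam i).Pert), b * s ≤ b' * s' →
      (fam i).C162 b s U₀ U₁ → (fam i).C162 b' s' U₀ U₁)
    (hmono137 : ∀ i α₁ α₁' (U₀ : (fam i).Cfg) (U₁ : (fam i).Pert), α₁ ≤ α₁' →
      (fam i).C137 α₁ U₀ U₁ → (fam i).C137 α₁' U₀ U₁) :
    ∀ i : I, ∀ α₀ α₁ : ℝ, 0 < α₀ → 0 < α₁ → α₀ + α₁ ≤ c₁ →
      ∀ U₀ : (fam i).Cfg, ∀ U' : (fam i).Pert,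
        (fam i).InA α₀ U₀ → (fam i).Reg335 α₀ U₀ → (fam i).InAAx α₀ U₀ U' → (fam i).avgClose α₁ U₀ U' →
          ∀ u u' : (fam i).GT,
            (fam i).Restricted U₀ u → (fam i).C136 (5 * d * L * inp.B₀) (5 * d * L * B₀β) (α₀ + α₁) U₀ ((fam i).act U' u) →
            (fam i).C137 α₁ U₀ ((fam i).act U' u) → (fam i).Landau U₀ ((fam i).act U' u) →
            (fam i).Restricted U₀ u' → (fam i).C136 (5 * d * L * inp.B₀) (5 * d * L * B₀β) (α₀ + α₁) U₀ ((fam i).act U' u') →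
            (fam i).C137 α₁ U₀ ((fam i).act U' u') → (fam i).Landau U₀ ((fam i).act U' u') → u' = u := by
  intro i α₀ α₁ h0 h1 hs U₀ U' hA hReg hAx hcl u u' hu h36 h37 h38 hu' h36' h37' h38'
  obtain ⟨e0, e4, _, _, _, _⟩ := hsched α₀ α₁ h0 h1 hs
  have hd' : (0 : ℝ) < d := by exact_mod_cast hd
  have hB₀ : 0 < inp.B₀ := inp.B₀_pos
  have hB₁pos : 0 < 5 * d * L * inp.B₀ := by positivity
  have hB₁'pos : 0 < B₁' := lt_of_lt_of_le hB₁pos hB₁'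
  set α₁' := 11 * (d : ℝ) ^ 2 * α₀ + α₁ with hα₁'
  have hα₁'pos : 0 < α₁' := by rw [hα₁']; positivity
  have hle' : α₁ ≤ α₁' := by rw [hα₁']; nlinarith [sq_nonneg (d : ℝ)]
  have h166 := h165 i α₀ α₁ U₀ U' h0 e0 hA hAx hcl
  obtain ⟨u₀, _, _, huniq⟩ := h4 i α₀ α₁' h0 hα₁'pos e4 U₀ U' hA hReg hAx h166
  have hbs : 5 * d * L * inp.B₀ * (α₀ + α₁) ≤ B₁' * (α₀ + α₁') :=
    mul_le_mul hB₁' (by linarith) (by positivity) hB₁'pos.le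
  -- both u and u′ satisfy Theorem 4's (1.37)[α₁′], (1.38), (1.62)[B′₁(α₀ + α₁′)], hence both equal Theorem 4's u₀
  have hu_eq : u = u₀ := huniq u hu (hmono137 i α₁ α₁' U₀ _ hle' h37) h38
    (hmono162 i _ _ _ _ U₀ _ hbs (h136_162 i _ _ _ U₀ _ h36))
  have hu'_eq : u' = u₀ := huniq u' hu' (hmono137 i α₁ α₁' U₀ _ hle' h37') h38'
    (hmono162 i _ _ _ _ U₀ _ hbs (h136_162 i _ _ _ U₀ _ h36'))
  rw [hu_eq, hu'_eq]

/-- **Consistency with the ∃-form**: the two halves at constants re-packaged as `B8.Thm2Printed` — Theorem 2 with `B₁ = 5dLB₀`,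
`B₂ = 5dLB₀(β₀)` and the scheduled `c₁` as witnesses (the same conclusion as `B8.thm2_of_thm4_prop3`, read through the bodies and an
explicit threshold). [cite: Balaban1985RegularSpaces, Thm 2 p.83 with Thm 4 ⇒ Thm 2 p.88 (bookkeeping)] -/
theorem thm2Printed_of_bodies (hd : 1 ≤ d) (hL : 0 < L) (hB₀β : 0 < B₀β) (hB₁' : 5 * d * L * inp.B₀ ≤ B₁') (hc₁ : 0 < c₁)
    (h4 : B8.Thm4Body c₄ B₁' (fun i => (fam i).toGFData))
    (h3 : B8.Prop3Body c₃ d L C₂ inp B₀β fam)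
    (hsched : ∀ α₀ α₁ : ℝ, 0 < α₀ → 0 < α₁ → α₀ + α₁ ≤ c₁ →
      α₀ ≤ c₀ ∧ α₀ + (11 * d ^ 2 * α₀ + α₁) ≤ c₄ ∧ α₀ ≤ c₃ ∧ α₁ ≤ c₃ ∧
      B₁' * (α₀ + (11 * d ^ 2 * α₀ + α₁)) ≤ c₃ ∧
      2 * (B₁' * (α₀ + (11 * d ^ 2 * α₀ + α₁))) ^ 2 + 20 * d * α₀ * (B₁' * (α₀ + (11 * d ^ 2 * α₀ + α₁))) +
        2 * C₂ * (B₁' * (α₀ + (11 * d ^ 2 * α₀ + α₁))) ^ 2 ≤ α₀ + α₁)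
    (h165 : ∀ i α₀ α₁ (U₀ : (fam i).Cfg) (U' : (fam i).Pert), 0 < α₀ → α₀ ≤ c₀ →
      (fam i).InA α₀ U₀ → (fam i).InAAx α₀ U₀ U' → (fam i).avgClose α₁ U₀ U' →
      (fam i).avgClose166 (11 * d ^ 2 * α₀ + α₁) U₀ U')
    (hginv : ∀ i α₀ (U₀ : (fam i).Cfg) (U' : (fam i).Pert) (u : (fam i).GT),
      (fam i).InAAx α₀ U₀ U' → (fam i).InAPair α₀ U₀ ((fam i).act U' u))
    (h137 : ∀ i α₁ b s (U₀ : (fam i).Cfg) (U' : (fam i).Pert) (u : (fam i).GT), (fam i).avgClose α₁ U₀ U' →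
      (fam i).Restricted U₀ u → (fam i).C162 b s U₀ ((fam i).act U' u) → (fam i).C137 α₁ U₀ ((fam i).act U' u))
    (h136_162 : ∀ i b b₂ s (U₀ : (fam i).Cfg) (U₁ : (fam i).Pert),
      (fam i).C136 b b₂ s U₀ U₁ → (fam i).C162 b s U₀ U₁)
    (hmono162 : ∀ i b s b' s' (U₀ : (fam i).Cfg) (U₁ : (fam i).Pert), b * s ≤ b' * s' →
      (fam i).C162 b s U₀ U₁ → (fam i).C162 b' s' U₀ U₁)
    (hmono137 : ∀ i α₁ α₁' (U₀ : (fam i).Cfg) (U₁ : (fam i).Pert), α₁ ≤ α₁' →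
      (fam i).C137 α₁ U₀ U₁ → (fam i).C137 α₁' U₀ U₁) :
    B8.Thm2Printed (fun i => (fam i).toGFData) := by
  have hd' : (0 : ℝ) < d := by exact_mod_cast hd
  have hB₀ : 0 < inp.B₀ := inp.B₀_pos
  have hB₁pos : 0 < 5 * d * L * inp.B₀ := by positivity
  have hB₁'pos : 0 < B₁' := lt_of_lt_of_le hB₁pos hB₁'
  have hex := thm2ExistsAt_of_bodies hd hB₁'pos h4 h3 hsched h165 hginv h137 hmono162
  have hun := thm2UniqueAt_of_bodies (B₀β := B₀β) hd hL hB₁' h4 hsched h165 h136_162 hmono162 hmono137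
  refine ⟨5 * d * L * inp.B₀, 5 * d * L * B₀β, c₁, hB₁pos, by positivity, hc₁, ?_⟩
  intro i α₀ α₁ h0 h1 hs U₀ U' hA hReg hAx hcl
  obtain ⟨u, hu, h36, h37, h38, h39⟩ := hex i α₀ α₁ h0 h1 hs U₀ U' hA hReg hAx hcl
  refine ⟨u, hu, ⟨h36, h37, h38, h39⟩, ?_⟩
  intro u' hu' h36' h37' h38' _
  exact hun i α₀ α₁ h0 h1 hs U₀ U' hA hReg hAx hcl u u' hu h36 h37 h38 hu' h36' h37' h38'

end AtConstants

end Literature.MathematicalPhysics.QuantumFieldTheory.Balaban1983to89.B8Thm2AtConstants
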